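import Summits.Langlands.Langlands.Theorems.RationalPeriodQuarterPeriodClassNontrivialOfBLZ
import Literature.NumberTheory.Automorphic.BLZPeriodCocycleProofs

/-!
# `PeriodCocycleIdentity` (support item of route `Langlands/RationalPeriodQuarter`) — proof

The typed Lewis–Zagier period functions of a weight-0, eigenvalue-1/4 cusp form `u` on `Γ₁(N)` satisfy the
inhomogeneous cocycle relation `r_{γδ} = r_γ|δ + r_δ` off finite sets ((5.4) of [BruggemanLewisZagier2015]).
By the bridge of `RationalPeriodQuarterPeriodClassNontrivialOfBLZ.lean` (`lzCocycle u γ = lewisZagierCocycle (1/2) i u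
(mapGL ℝ γ)`, `slashHalf δ = lineSlash (1/2) (mapGL ℝ δ)`, a quarter cusp form is an invariant `λ_{1/2}`-eigenfunction
of the determinant-one image of `Γ₁(N)` in `GL₂(ℝ)`) this is the Literature theorem `lewisZagierCocycle_mul_cofinite`
(`BLZPeriodCocycleProofs`, §8 "cocycle law": Möbius change of variables in the Green's-form segment integral +
additivity of periods, for `s ≠ 0, 1`).

References: [BruggemanLewisZagier2015] R. Bruggeman, J. Lewis, D. Zagier, *Period functions for Maass wave forms and
cohomology*, Mem. AMS 237 no. 1118 (2015), doi:10.1090/memo/1118 — (5.4)–(5.5a) p. 29.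
-/

noncomputable section

set_option linter.dupNamespace false

namespace Summit.Langlands.Langlands.Theorems

open Literature.NumberTheory.Automorphic

/-- **Support item `PeriodCocycleIdentity`**: `lzCocycle u (γδ) = (lzCocycle u γ)|δ + lzCocycle u δ` off a finite set,
for `γ, δ ∈ Γ₁(N)` and a quarter cusp form `u`. [cite: BruggemanLewisZagier2015, (5.4)–(5.5a) p. 29] -/
theorem periodCocycleIdentity :
    Summit.Langlands.Langlands.Theses.RationalPeriodQuarter.PeriodCocycleIdentity := by
  intro N _hN u hu γ hγ δ hδ
  obtain ⟨hC2, hinv, heig, _hbd⟩ := hu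
  have hu' := isInvariantEigenfunction_half_of_quarter hC2 hinv heig
  have key := lewisZagierCocycle_mul_cofinite hu' (by norm_num) (by norm_num)
    (Subgroup.mem_map_of_mem (Matrix.SpecialLinearGroup.mapGL ℝ) hγ)
    (Subgroup.mem_map_of_mem (Matrix.SpecialLinearGroup.mapGL ℝ) hδ) UpperHalfPlane.I
  filter_upwards [key] with t ht
  rw [← map_mul, lineSlash_half_mapGL] at ht
  simp only [← lzCocycle_eq_lewisZagierCocycle] at ht
  exact ht

end Summit.Langlands.Langlands.Theorems
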